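import Summits.BirchSwinnertonDyer.BirchSwinnertonDyer.Theorems.ResidualThetaTransportAtTwoResidualSignedLambdaLowerCMAtTwoLambdaAssembly
import Summits.BirchSwinnertonDyer.BirchSwinnertonDyer.Theorems.ResidualThetaTransportAtTwoCmLambdaLowerOfCorank
import Literature.NumberTheory.EllipticCurves.Kato2004.IwasawaCohomologyCoeffNewform
import HarnessLib

/-!
# Sketch (stub-ideation k = 3, gen 4, technique family: DECOMPOSITION) for the registered stub
# `stub_cmLambdaLower : …Theses.ResidualThetaTransportAtTwo.ResidualSignedLambdaLowerCMAtTwo` (RSL_g)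
# of skeleton «bt26-lambda», crux (R≥)ᵖ `ResidualThetaCountLowerPureAtTwo` (stmt-BirchSwinnertonDyer-26074)

Idea file: `Cruxes/ResidualThetaCountLowerPureAtTwo/Ideas/stub-cmlambdalower-k3-g4.md` (slug `stub-cmlambdalower-k3-g4`).

WHAT IS TYPED HERE (no arithmetic is proved; BSD is NOT proved; stmt-…-26074 and RSL_g = stmt-…-22608 stay OPEN):

* §G  two GLUE helpers the cut needs and the tree lacks:
  - `finrank_baseChange_quotient_span_eq_of_normLambda_field` / `…_iwasawaAlgebraO` — the **μ-safe** identity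
    `dim_K (K ⊗_𝒪 Λ_𝒪/(F)) = normλ(F)` for ANY fraction field `K` of `𝒪` (the tree's
    `LambdaLowerBoundO.finrank_baseChange_quotient_span_eq_of_normLambda` is pinned to `K = E = ℚ_p(S)` with the unit-ball
    algebra instance; its `…quotientTorsion…_iwasawaAlgebraO` twin is intrinsic but the bridge
    `finrank_baseChange_eq_finrank_quotientTorsion` to the kit's `K ⊗`-currency (the `hm` of
    `CharIdealLambda.le_finrank_baseChange_of_fourTerm`) needs `Module.Finite 𝒪 (Λ_𝒪/(F))`, i.e. `μ(F) = 0`, which fails for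
    `F = c·Lm` as soon as the ERL constant `c` is a non-unit or `μ(Lm) > 0` — neither excluded by the crux's binders; this closes
    that currency gap in the ALGEBRA-KIT-g15 §2 recipe).
* §1  `corank_ge_of_sockets` — the kernel-checked composition of the five sub-stub OUTPUTS of the card's cut
    (S-b four-term with middle term `Λ_𝒪/(F)`, S-d norm pattern of `F = 𝒸 z` at `d' ≥ d`, S-c(ii) one-sided λ-flank, S-e imprimitive
    increment, finite branch) into the `hcorank` currency `d + Σ ≤ rank_𝒪(X⁺_{S₀}/tors)` of `LambdaLowerBoundO.cmLambdaLower_of_corank`,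
    on the crux's own carriers `𝒪 = padicCoeffIntegers S`, `Λ_𝒪 = IwasawaAlgebraO S` — every step a landed kit lemma
    (`CharIdealLambda.le_finrank_baseChange_of_fourTerm`, `…add_le_finrank_baseChange_of_shortExact`,
    `…le_finrank_quotientTorsion_of_le_finrank_baseChange`).
* §2  `CorankSockets` (the per-datum bundle of the five sub-stub outputs, verbatim on RSL_g's binders, finite branch) and
    `residualSignedLambdaLowerCMAtTwo_of_corankSockets : CorankSockets → RSL_g` — RSL_g BY NAME (the infinite branch is
    discharged inside: `Set.encard = ⊤`, `natCast_le_encard_of_finite_imp`), via §1 and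
    `LambdaLowerBoundO.pow_le_encard_of_dualPair_of_subset`.  `lean check`: rc 0, NO `sorry` anywhere; the audit classifies the
    theorem `proof.conditional` on `hsock : CorankSockets` (credits nothing — as intended: the five sub-stubs are the debt).
* NOT typed here (vocabulary pending, same dependency as STUB-PLAN rev 4 §3.1 (i)): the value spec `VS(𝒸)` of the global
  plus-Coleman functional and the norm-form value clause `NV(z)` of the HOLD — both need Tate-pairing values of layer classes of
  `IwasawaH1DataCoeff ρ.toGaloisRep 2 κ γ` against Θ-transported plus points (the `g`-twin of
  `Kato2004.exists_eulerSystem_expStar_tatePairing_values_two`); the sub-stub signatures are given in the card over these two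
  predicates, and compose to `CorankSockets` by first-order logic (S-a ∃𝒸; S-c ∃z; S-b, S-d universal in `𝒸`, `z`).
-/

-- the Cruxes namespace of this sub repeats the summit name by design (D-0017 nested layout)
set_option linter.dupNamespace false

noncomputable section

open scoped TensorProduct
open PowerSeries

namespace Summit.BirchSwinnertonDyer.BirchSwinnertonDyer.Cruxes.ResidualThetaCountLowerPureAtTwo.StubIdeasK3G4

open Summit.BirchSwinnertonDyer.BirchSwinnertonDyer.Theorems
open Literature.NumberTheory.Automorphic Literature.NumberTheory.EllipticCurves

universe w

/-! ## §G  Glue helpers: `dim_K (K ⊗_𝒪 Λ_𝒪/(F)) = normλ(F)` for any fraction field `K` (μ-safe) -/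

section GlueLambdaQ

variable (p : ℕ) [Fact p.Prime] (E : IntermediateField ℚ_[p] (PadicAlgCl p)) [FiniteDimensional ℚ_[p] E]

/-- **G-λQ (field-generic).** For `L ∈ 𝒪_E⟦T⟧`, `L ≠ 0`, whose coefficient norms are maximal first at index `d`
(`normλ(L) = d`, any `μ`), and ANY fraction field `K` of `𝒪_E`: `dim_K (K ⊗_{𝒪_E} 𝒪_E⟦T⟧/(L)) = d`.
Same proof as `LambdaLowerBoundO.finrank_baseChange_quotient_span_eq_of_normLambda` (`L = C(c)·L₀`, `𝒪⟦T⟧/(L₀)` free of rank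
`d`, the kernel of `𝒪⟦T⟧/(L) ↠ 𝒪⟦T⟧/(L₀)` is `c`-torsion), with `c ≠ 0 ⇒ c` a unit in `K` by `IsFractionRing` instead of the
norm on `E`. [cite: Washington1997, §7.1 Thm. 7.3 and §13.2] -/
theorem finrank_baseChange_quotient_span_eq_of_normLambda_field (K : Type w) [Field K]
    [Algebra (PadicIntermediateField.unitBall p E) K] [IsFractionRing (PadicIntermediateField.unitBall p E) K]
    (L : PowerSeries (PadicIntermediateField.unitBall p E)) (d : ℕ) (hL : L ≠ 0)
    (hle : ∀ k, ‖((coeff k L : PadicIntermediateField.unitBall p E) : PadicAlgCl p)‖ ≤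
      ‖((coeff d L : PadicIntermediateField.unitBall p E) : PadicAlgCl p)‖)
    (hlt : ∀ k, k < d → ‖((coeff k L : PadicIntermediateField.unitBall p E) : PadicAlgCl p)‖ <
      ‖((coeff d L : PadicIntermediateField.unitBall p E) : PadicAlgCl p)‖) :
    Module.finrank K (K ⊗[PadicIntermediateField.unitBall p E]
      (PowerSeries (PadicIntermediateField.unitBall p E) ⧸ Ideal.span {L})) = d := by
  obtain ⟨L₀, hfac, hc0, hd1, hlow⟩ := LambdaLowerBoundO.exists_eq_C_mul_of_normLambda p E L d hL hle hlt
  set c := coeff d L with hc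
  obtain ⟨hfree, hfin, hrank⟩ :=
    LambdaLowerBoundO.free_finrank_quotient_span_of_order_eq p E L₀ d (LambdaLowerBoundO.order_map_residue_eq L₀ d hd1 hlow)
  haveI := hfree
  haveI := hfin
  have hle' : Ideal.span {L} ≤ Ideal.span {L₀} := by
    rw [Ideal.span_singleton_le_span_singleton, hfac]
    exact Dvd.intro_left _ rfl
  let π : (PowerSeries (PadicIntermediateField.unitBall p E) ⧸ Ideal.span {L}) →ₐ[
      PadicIntermediateField.unitBall p E]
      (PowerSeries (PadicIntermediateField.unitBall p E) ⧸ Ideal.span {L₀}) :=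
    Ideal.Quotient.factorₐ (PadicIntermediateField.unitBall p E) hle'
  have hπ : Function.Surjective π.toLinearMap := Ideal.Quotient.factor_surjective hle'
  have hker : ∀ x ∈ LinearMap.ker π.toLinearMap, c • x = 0 := by
    intro x hx
    obtain ⟨y, rfl⟩ := Ideal.Quotient.mk_surjective x
    rw [LinearMap.mem_ker, AlgHom.toLinearMap_apply, Ideal.Quotient.factorₐ_apply_mk,
      Ideal.Quotient.eq_zero_iff_mem, Ideal.mem_span_singleton'] at hx
    obtain ⟨z, rfl⟩ := hx
    change Ideal.Quotient.mk (Ideal.span {L}) (c • (z * L₀)) = 0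
    rw [Ideal.Quotient.eq_zero_iff_mem, smul_eq_C_mul, Ideal.mem_span_singleton']
    exact ⟨z, by rw [hfac]; ring⟩
  have hcK : IsUnit (algebraMap (PadicIntermediateField.unitBall p E) K c) := by
    rw [isUnit_iff_ne_zero]
    exact IsFractionRing.to_map_ne_zero_of_mem_nonZeroDivisors (mem_nonZeroDivisors_of_ne_zero hc0)
  rw [LambdaLowerBoundO.finrank_baseChange_eq_of_surjective_of_smul_ker_eq_zero K π.toLinearMap hπ c hcK hker,
    Module.finrank_baseChange, hrank]

end GlueLambdaQ

section GlueLambdaQCrux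

variable {p : ℕ} [Fact p.Prime]

/-- **G-λQ on the crux's carriers** `𝒪 = padicCoeffIntegers S`, `Λ_𝒪 = IwasawaAlgebraO S`, norms of the coefficients of
`iwasawaOToPowerSeries S F` exactly as in the binders of RSL_g (`S = Set.range ι`, `F = c·Lm` or `F = 𝒸 z`), for ANY fraction
field `K` of `𝒪` (e.g. the kit's `K`, or `FractionRing 𝒪`): `dim_K (K ⊗_𝒪 Λ_𝒪/(F)) = d` — with NO `μ(F) = 0` hypothesis.
[cite: Washington1997, §7.1 Thm. 7.3 and §13.2] -/
theorem finrank_baseChange_quotient_span_eq_of_normLambda_iwasawaAlgebraO (S : Set (PadicAlgCl p))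
    [FiniteDimensional ℚ_[p] (padicCoeffField S)] :
    ∀ (K : Type w) [Field K] [Algebra (padicCoeffIntegers S) K] [IsFractionRing (padicCoeffIntegers S) K]
      (F : IwasawaAlgebraO S) (d : ℕ), F ≠ 0 →
      (∀ k : ℕ, ‖coeff k (iwasawaOToPowerSeries S F)‖ ≤ ‖coeff d (iwasawaOToPowerSeries S F)‖) →
      (∀ k : ℕ, k < d → ‖coeff k (iwasawaOToPowerSeries S F)‖ < ‖coeff d (iwasawaOToPowerSeries S F)‖) →
      Module.finrank K (K ⊗[padicCoeffIntegers S] (IwasawaAlgebraO S ⧸ Ideal.span {F})) = d := by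
  simp only [coeff_iwasawaOToPowerSeries]
  unfold IwasawaAlgebraO
  rw [padicCoeffIntegers_eq_unitBall S]
  intro K _ _ _ F d hF hle hlt
  exact finrank_baseChange_quotient_span_eq_of_normLambda_field p (padicCoeffField S) K F d hF hle hlt

end GlueLambdaQCrux


/-! ## §O  ONE-SIDED rank–nullity after `K ⊗_R ·` (k1-g4 cut (2) = STUB-PLAN rev 5.2 §11.2/(α), proved here generically):
no injectivity of the first map, no exactness equalities — only `ker g ≤ range f`, `range g ≤ ker h`, `h` onto. -/

section OneSided

variable {R : Type*} [CommRing R] (K : Type*) [Field K] [Algebra R K] [IsFractionRing R K]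
variable {M₁ M₂ M₃ M₄ : Type*} [AddCommGroup M₁] [Module R M₁] [AddCommGroup M₂] [Module R M₂]
  [AddCommGroup M₃] [Module R M₃] [AddCommGroup M₄] [Module R M₄]

/-- **One-sided four-term inequality** `dim(K⊗M₂) + dim(K⊗M₄) ≤ dim(K⊗M₁) + dim(K⊗M₃)` for `R`-linear
`M₁ →f M₂ →g M₃ →h M₄` with `ker g ≤ range f`, `range g ≤ ker h`, `h` surjective (`K = Frac R`, flat). With `f` injective and
both inclusions equalities this is `LambdaLowerBoundO.finrank_baseChange_add_eq_of_exact`; the point (k1-g4 B1, adopted by the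
critic, rev 5.2 §11.2) is that the S2 consumer needs only this half, so `𝔖 = 0` (node N3) leaves the dependency list.
[cite: Washington1997, §13.2] -/
theorem finrank_baseChange_fourTerm_le_oneSided (f : M₁ →ₗ[R] M₂) (g : M₂ →ₗ[R] M₃) (h : M₃ →ₗ[R] M₄)
    (hfg : LinearMap.ker g ≤ LinearMap.range f) (hgh : LinearMap.range g ≤ LinearMap.ker h)
    (hh : Function.Surjective h)
    [FiniteDimensional K (K ⊗[R] M₁)] [FiniteDimensional K (K ⊗[R] M₂)] [FiniteDimensional K (K ⊗[R] M₃)] :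
    Module.finrank K (K ⊗[R] M₂) + Module.finrank K (K ⊗[R] M₄) ≤
      Module.finrank K (K ⊗[R] M₁) + Module.finrank K (K ⊗[R] M₃) := by
  haveI : Module.Flat R K := IsLocalization.flat K (nonZeroDivisors R)
  set g' := g.baseChange K with hg'
  set h' := h.baseChange K with hh'
  have hcomp : h ∘ₗ g = 0 := LinearMap.range_le_ker_iff.mp hgh
  have hgh' : LinearMap.range g' ≤ LinearMap.ker h' := by
    rw [LinearMap.range_le_ker_iff, hg', hh', ← LinearMap.baseChange_comp, hcomp, LinearMap.baseChange_zero]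
  have hh's : Function.Surjective h' := by
    rw [hh', LinearMap.baseChange_eq_ltensor]
    exact LinearMap.lTensor_surjective K hh
  -- `ker g` is covered by the submodule `P = f⁻¹(ker g)` of `M₁`
  set P := Submodule.comap f (LinearMap.ker g) with hP
  have hex : Function.Exact (f ∘ₗ P.subtype) g := by
    intro y
    constructor
    · intro hy
      obtain ⟨x, rfl⟩ := LinearMap.mem_range.mp (hfg (LinearMap.mem_ker.mpr hy))
      exact ⟨⟨x, Submodule.mem_comap.mpr (LinearMap.mem_ker.mpr hy)⟩, rfl⟩
    · rintro ⟨x, rfl⟩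
      exact LinearMap.mem_ker.mp (Submodule.mem_comap.mp x.2)
  have hex' : Function.Exact ((f ∘ₗ P.subtype).baseChange K) g' := by
    rw [hg', LinearMap.baseChange_eq_ltensor, LinearMap.baseChange_eq_ltensor]
    exact Module.Flat.lTensor_exact K hex
  have hPinj : Function.Injective ((P.subtype).baseChange K) := by
    rw [LinearMap.baseChange_eq_ltensor]
    exact Module.Flat.lTensor_preserves_injective_linearMap _ P.injective_subtype
  haveI : FiniteDimensional K (K ⊗[R] P) := Module.Finite.of_injective _ hPinj
  have hker : Module.finrank K (LinearMap.ker g') ≤ Module.finrank K (K ⊗[R] M₁) := by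
    rw [LinearMap.exact_iff.mp hex']
    exact (LinearMap.finrank_range_le _).trans (LinearMap.finrank_le_finrank_of_injective hPinj)
  have h3 := LinearMap.finrank_range_add_finrank_ker h'
  rw [LinearMap.range_eq_top.mpr hh's, finrank_top] at h3
  have h2 := LinearMap.finrank_range_add_finrank_ker g'
  have hmono := Submodule.finrank_mono hgh'
  omega

omit [AddCommGroup M₄] [Module R M₄] in
/-- **One-sided three-term inequality** `dim(K⊗M₁) + dim(K⊗M₃) ≤ dim(K⊗M₂)` for `M₁ →i M₂ →π M₃` with `i` injective,
`range i ≤ ker π`, `π` surjective — the half of `CharIdealLambda.add_le_finrank_baseChange_of_shortExact` the imprimitive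
increment needs. [cite: Washington1997, §13.2] [cite: GreenbergVatsal2000, §2] -/
theorem finrank_baseChange_threeTerm_le_oneSided (i : M₁ →ₗ[R] M₂) (π : M₂ →ₗ[R] M₃) (hi : Function.Injective i)
    (hiπ : LinearMap.range i ≤ LinearMap.ker π) (hπ : Function.Surjective π) [FiniteDimensional K (K ⊗[R] M₂)] :
    Module.finrank K (K ⊗[R] M₁) + Module.finrank K (K ⊗[R] M₃) ≤ Module.finrank K (K ⊗[R] M₂) := by
  haveI : Module.Flat R K := IsLocalization.flat K (nonZeroDivisors R)
  set i' := i.baseChange K with hi'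
  set π' := π.baseChange K with hπ'
  have hcomp : π ∘ₗ i = 0 := LinearMap.range_le_ker_iff.mp hiπ
  have hiπ' : LinearMap.range i' ≤ LinearMap.ker π' := by
    rw [LinearMap.range_le_ker_iff, hi', hπ', ← LinearMap.baseChange_comp, hcomp, LinearMap.baseChange_zero]
  have hi'inj : Function.Injective i' := by
    rw [hi', LinearMap.baseChange_eq_ltensor]
    exact Module.Flat.lTensor_preserves_injective_linearMap i hi
  have hπ's : Function.Surjective π' := by
    rw [hπ', LinearMap.baseChange_eq_ltensor]
    exact LinearMap.lTensor_surjective K hπ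
  have h1 : Module.finrank K (K ⊗[R] M₁) = Module.finrank K (LinearMap.range i') :=
    (LinearEquiv.ofInjective i' hi'inj).finrank_eq
  have h3 := LinearMap.finrank_range_add_finrank_ker π'
  rw [LinearMap.range_eq_top.mpr hπ's, finrank_top] at h3
  have hmono := Submodule.finrank_mono hiπ'
  omega

end OneSided

/-! ## §1  The socket composition in `hcorank` currency (all steps = landed kit lemmas) -/

section Composition

variable {p : ℕ} [Fact p.Prime]

/-- `𝒪 = padicCoeffIntegers S` is a complete discrete valuation ring (`ℚ_p(S)/ℚ_p` finite): the unit-ball instances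
`LambdaLowerBoundO.isDiscreteValuationRing_unitBall`, `…isAdicComplete_maximalIdeal_unitBall` transported along
`padicCoeffIntegers_eq_unitBall` in ONE rewrite (so that no instance already in context blocks the motive).
[cite: NeukirchANT1999, Ch. II (4.8)] -/
theorem exists_isDiscreteValuationRing_isAdicComplete_padicCoeffIntegers (S : Set (PadicAlgCl p))
    [FiniteDimensional ℚ_[p] (padicCoeffField S)] :
    ∃ _ : IsDiscreteValuationRing (padicCoeffIntegers S),
      IsAdicComplete (IsLocalRing.maximalIdeal (padicCoeffIntegers S)) (padicCoeffIntegers S) := by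
  rw [padicCoeffIntegers_eq_unitBall S]
  exact ⟨LambdaLowerBoundO.isDiscreteValuationRing_unitBall p _,
    LambdaLowerBoundO.isAdicComplete_maximalIdeal_unitBall p _⟩

/-- **Glue of the k3-g4 cut.** On the crux's carriers (`𝒪 = padicCoeffIntegers S`, `Λ_𝒪 = IwasawaAlgebraO S`, `K` any
fraction field of `𝒪`), the OUTPUTS of the five sub-stubs compose to the `hcorank` inequality of
`LambdaLowerBoundO.cmLambdaLower_of_corank`:
* S-d (value/index seam, instantiated at `F := 𝒸 z`): the norm pattern of `F` at an index `d' ≥ d`, `F ≠ 0`;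
* S-b (ONE-SIDED four-term, instantiated at `𝒸`, `z` and the pinned dual pairs): `𝒪`-linear
  `H1Z →f Λ_𝒪/(F) →g X →h X0` with `ker g ≤ range f`, `range g ≤ ker h`, `h` onto (`H1Z = 𝐇¹/Λz`, `X = X⁺_∅`, `X0 = X₀`),
  `H1Z`, `X` finitely generated torsion `Λ_𝒪`-modules — NO injectivity of `f` (node N3 `𝔖 = 0` is not needed);
* S-c(ii) (one-sided MC flank in λ-currency): `dim_K(K ⊗ H1Z) ≤ dim_K(K ⊗ X0)`;
* S-e (imprimitive increment, one-sided): `L →i XS →π X`, `i` injective, `range i ≤ ker π`, `π` onto (`XS = X⁺_{S₀}`),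
  `s ≤ dim_K(K ⊗ L)`, and (finite branch) `XS` finitely generated over `𝒪`;
then `d + s ≤ rank_𝒪(XS/XS_tors)`.  No witness is shared between the hypotheses beyond the modules they are ABOUT.
[cite: Kobayashi2003, Thm. 7.3 ((7.21), p. 13)] [cite: GreenbergVatsal2000, §2 (Cor. 2.3)] [cite: Washington1997, §7.1, §13.2] -/
theorem corank_ge_of_sockets (S : Set (PadicAlgCl p)) [FiniteDimensional ℚ_[p] (padicCoeffField S)]
    (K : Type w) [Field K] [Algebra (padicCoeffIntegers S) K] [IsFractionRing (padicCoeffIntegers S) K]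
    {H1Z X X0 L XS : Type}
    [AddCommGroup H1Z] [Module (IwasawaAlgebraO S) H1Z] [Module (padicCoeffIntegers S) H1Z]
    [IsScalarTower (padicCoeffIntegers S) (IwasawaAlgebraO S) H1Z] [Module.Finite (IwasawaAlgebraO S) H1Z]
    [AddCommGroup X] [Module (IwasawaAlgebraO S) X] [Module (padicCoeffIntegers S) X]
    [IsScalarTower (padicCoeffIntegers S) (IwasawaAlgebraO S) X] [Module.Finite (IwasawaAlgebraO S) X]
    [AddCommGroup X0] [Module (padicCoeffIntegers S) X0]
    [AddCommGroup L] [Module (padicCoeffIntegers S) L]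
    [AddCommGroup XS] [Module (IwasawaAlgebraO S) XS] [Module (padicCoeffIntegers S) XS]
    [IsScalarTower (padicCoeffIntegers S) (IwasawaAlgebraO S) XS] [Module.Finite (IwasawaAlgebraO S) XS]
    [Module.Finite (padicCoeffIntegers S) XS]
    -- S-d output: the norm pattern of `F = 𝒸 z` at `d' ≥ d`
    (F : IwasawaAlgebraO S) (d' : ℕ) (hF : F ≠ 0)
    (hle : ∀ k : ℕ, ‖coeff k (iwasawaOToPowerSeries S F)‖ ≤ ‖coeff d' (iwasawaOToPowerSeries S F)‖)
    (hlt : ∀ k : ℕ, k < d' → ‖coeff k (iwasawaOToPowerSeries S F)‖ < ‖coeff d' (iwasawaOToPowerSeries S F)‖)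
    {d : ℕ} (hd : d ≤ d')
    -- S-b output: the ONE-SIDED four-term sequence with middle term `Λ_𝒪/(F)`; `H1Z`, `X` torsion
    (hH : Module.IsTorsion (IwasawaAlgebraO S) H1Z) (hX : Module.IsTorsion (IwasawaAlgebraO S) X)
    (f : H1Z →ₗ[padicCoeffIntegers S] (IwasawaAlgebraO S ⧸ Ideal.span {F}))
    (g : (IwasawaAlgebraO S ⧸ Ideal.span {F}) →ₗ[padicCoeffIntegers S] X)
    (h : X →ₗ[padicCoeffIntegers S] X0)
    (hfg : LinearMap.ker g ≤ LinearMap.range f) (hgh : LinearMap.range g ≤ LinearMap.ker h) (hh : Function.Surjective h)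
    -- S-c(ii) output: one-sided flank in λ-currency
    (hflank : Module.finrank K (K ⊗[padicCoeffIntegers S] H1Z) ≤ Module.finrank K (K ⊗[padicCoeffIntegers S] X0))
    -- S-e output: imprimitive increment
    (hXS : Module.IsTorsion (IwasawaAlgebraO S) XS)
    (i : L →ₗ[padicCoeffIntegers S] XS) (π : XS →ₗ[padicCoeffIntegers S] X)
    (hi : Function.Injective i) (hiπ : LinearMap.range i ≤ LinearMap.ker π) (hπ : Function.Surjective π)
    {s : ℕ} (hs : s ≤ Module.finrank K (K ⊗[padicCoeffIntegers S] L)) :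
    d + s ≤ Module.finrank (padicCoeffIntegers S) (XS ⧸ Submodule.torsion (padicCoeffIntegers S) XS) := by
  obtain ⟨instDVR, instComplete⟩ := exists_isDiscreteValuationRing_isAdicComplete_padicCoeffIntegers S
  haveI := instDVR
  haveI := instComplete
  have hQ : Module.IsTorsion (IwasawaAlgebraO S) (IwasawaAlgebraO S ⧸ Ideal.span {F}) :=
    CharIdealLambda.isTorsion_quotient_span_singleton hF
  have hval : d ≤ Module.finrank K (K ⊗[padicCoeffIntegers S] (IwasawaAlgebraO S ⧸ Ideal.span {F})) := by
    rw [finrank_baseChange_quotient_span_eq_of_normLambda_iwasawaAlgebraO S K F d' hF hle hlt]; exact hd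
  haveI := CharIdealLambda.finite_baseChange_of_isTorsion K H1Z hH
  haveI := CharIdealLambda.finite_baseChange_of_isTorsion K (IwasawaAlgebraO S ⧸ Ideal.span {F}) hQ
  haveI := CharIdealLambda.finite_baseChange_of_isTorsion K X hX
  haveI := CharIdealLambda.finite_baseChange_of_isTorsion K XS hXS
  have h4 := finrank_baseChange_fourTerm_le_oneSided K f g h hfg hgh hh
  have h3 := finrank_baseChange_threeTerm_le_oneSided K i π hi hiπ hπ
  have h2 : d + s ≤ Module.finrank K (K ⊗[padicCoeffIntegers S] XS) := by omega
  exact CharIdealLambda.le_finrank_quotientTorsion_of_le_finrank_baseChange K h2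

end Composition


/-! ## §2  RSL_g BY NAME from the per-datum socket bundle (finite branch; the infinite branch is discharged here) -/

section ByName

open Literature.NumberTheory.EllipticCurves GreenbergSelmer GreenbergVatsal2000 Kobayashi2003 ModularForms Rank1Residual
  Literature.NumberTheory.GaloisRepresentations Literature.NumberTheory.Automorphic IsDedekindDomain NumberField Field
  Rat.HeightOneSpectrum PowerSeries

/-- A lower bound on an extended cardinality may assume the set finite (else `encard = ⊤`). [folklore] -/
theorem natCast_le_encard_of_finite_imp {α : Type*} {T : Set α} {m : ℕ} (h : T.Finite → (m : ℕ∞) ≤ T.encard) :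
    (m : ℕ∞) ≤ T.encard := by
  by_cases hfin : T.Finite
  · exact h hfin
  · rw [Set.Infinite.encard_eq hfin]; exact le_top

/-- **The socket bundle of the k3-g4 cut, per RSL_g datum, FINITE BRANCH ONLY** (guard: the counted set `𝒮[ϖ]` is finite).
Verbatim the binders of RSL_g (= those of `LambdaLowerBoundO.cmLambdaLower_of_corank`'s `hcorank`), then: a scalar-stable
subgroup `Sg ⊆ 𝒮` with its PINNED dual pair `X = X⁺_{S₀}` (`toDual : X ≅ Hom(Sg, ℚ/ℤ)`, constants through `scalarH1`;
finite branch: `X` finitely generated over `𝒪` and `Λ_𝒪`-torsion), and the OUTPUTS of the five sub-stubs: S-d (norm pattern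
of `F = 𝒸 z` at `d' ≥ d`), S-b (ONE-SIDED four-term `H1Z → Λ_𝒪/(F) → X⁺_∅ → X₀`: `ker ≤ range`, `range ≤ ker`, onto; `H1Z`, `X⁺_∅` f.g. torsion), S-c(ii) (one-sided λ-flank,
`K = Frac 𝒪`), S-e (imprimitive increment `L ↪ X ↠ X⁺_∅`, `range ≤ ker`, with `Σ_g(S₀) ≤ λ(L)`). Each conjunct is supplied by ONE
sub-stub instantiated at the witnesses of S-a (`𝒸`) and S-c (`z`); no sub-stub signature shares a witness with another
(card §Plan A). Nothing asserted: a `Prop`. -/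
def CorankSockets : Prop :=
  open Literature.NumberTheory.EllipticCurves GreenbergSelmer GreenbergVatsal2000 Kobayashi2003 ModularForms Rank1Residual Literature.NumberTheory.GaloisRepresentations Literature.NumberTheory.Automorphic IsDedekindDomain NumberField Field Rat.HeightOneSpectrum PowerSeries in ∀ (W : WeierstrassCurve ℚ) [W.IsElliptic] [W.IsGloballyMinimal], ¬ W.HasCM → W.analyticRank = 0 → GoodSS W 2 → W.frobeniusTrace 2 = 0 → W.Δ < 0 → ∀ (M : ℕ) [NeZero M] (g : CuspForm (CongruenceSubgroup.Gamma0 M) 2) (ι : coeffField g →+* PadicAlgCl 2) (Ω : ℂ), Odd M → IsNewform0 g → IsCMForm (liftToGamma1 M 2 g) → cuspCoeff g 2 = 0 → IsCohomologicalPlusPeriod g ι Ω → (∀ ℓ : ℕ, ℓ.Prime → ¬ ℓ ∣ 2 * M * W.conductorNorm ℤ → ‖embCoeff g ι ℓ - (W.frobeniusTrace ℓ : PadicAlgCl 2)‖ < 1) → ∀ (κ : ZpExtension ℚ 2) (γ : absoluteGaloisGroup ℚ), κ.IsCyclotomic → κ.IsTopGenerator γ → IsCyclotomicVariable 2 γ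 → ∀ (S₀ : Finset (HeightOneSpectrum (RingOfIntegers ℚ))), (∀ v ∈ S₀, ((2 : ℕ) : RingOfIntegers ℚ) ∉ v.asIdeal) → (∀ v, ¬ W.HasGoodReductionAt v → v ∈ S₀) → (∀ v, natGenerator v ∣ M → v ∈ S₀) → ∀ (Lp Lm : IwasawaAlgebraO (Set.range ι)) (d : ℕ), IsPollackPairK g ι Ω Lp Lm → (∀ k, ‖coeff k (iwasawaOToPowerSeries (Set.range ι) Lm)‖ ≤ ‖coeff d (iwasawaOToPowerSeries (Set.range ι) Lm)‖) → (∀ k < d, ‖coeff k (iwasawaOToPowerSeries (Set.range ι) Lm)‖ < ‖coeff d (iwasawaOToPowerSeries (Set.range ι) Lm)‖) → ∀ (n : ℕ) (ρ : FramedGaloisRep ℚ ↥(padicCoeffIntegers (Set.range ι)) 2) (Θ : ∀ v : HeightOneSpectrum (RingOfIntegers ℚ), ((2 : ℕ) : RingOfIntegers ℚ) ∈ v.asIdeal → (Cofree ρ ↥(padicCoeffField (Set.range ι)) ≃+ (Fin n → ↥(W.geomPrimaryTorsion 2)))), (∀ v, ¬ natGenerator v ∣ 2 * M → ρ.IsUnramifiedAt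 v ∧ ∃ P : Polynomial ↥(padicCoeffIntegers (Set.range ι)), P.map (padicCoeffIntegers (Set.range ι)).subtype = Polynomial.X ^ 2 - Polynomial.C (embCoeff g ι (natGenerator v)) * Polynomial.X + Polynomial.C ((natGenerator v : ℕ) : PadicAlgCl 2) ∧ ρ.HasFrobCharpolyAt v P) → (∀ v hv (δ : absoluteGaloisGroup (v.adicCompletion ℚ)) m i, Θ v hv (resGalOfEmb (closureEmb (K := ℚ) (v.adicCompletion ℚ)) δ • m) i = resGalOfEmb (closureEmb (K := ℚ) (v.adicCompletion ℚ)) δ • Θ v hv m i) → ∀ (ϖ : ↥(padicCoeffIntegers (Set.range ι))), Irreducible ϖ → Set.Finite {y : subgroupH1 κ.kerSubgroup (Cofree ρ ↥(padicCoeffField (Set.range ι))) | y ∈ unramifiedOutside κ.kerSubgroup (Cofree ρ ↥(padicCoeffField (Set.range ι))) 2 ↑S₀ ∧ (∀ w σ, conjH1 κ.kerSubgroup (Cofree ρ ↥(padicCoeffField (Set.range ι))) σ y ∈ infKer κ.kerSubgroup (Cofree ρ ↥(padicCoeffField (Set.range ι))) w) ∧ (∀ v hv σ, ∃ (φ : _)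 (Q : Fin n → localPoints W (v.adicCompletion ℚ)) (k : ℕ), oneCocycleClass (discreteTopRep ↥κ.kerSubgroup (Cofree ρ ↥(padicCoeffField (Set.range ι)))) φ = conjH1 κ.kerSubgroup (Cofree ρ ↥(padicCoeffField (Set.range ι))) σ y ∧ (∀ i, (2 ^ k) • Q i ∈ ⨆ m : ℕ, signedLocalPoints κ (v.adicCompletion ℚ) W 1 m) ∧ ∀ τ i, pointsMapOfEmb W (closureEmb (K := ℚ) (v.adicCompletion ℚ)) (((Θ v hv (φ.1 (resGalSubgroupOfEmb κ.kerSubgroup (closureEmb (K := ℚ) (v.adicCompletion ℚ)) τ))) i : ↥(W.geomPrimaryTorsion 2)) : W.geomPoints) = (τ : absoluteGaloisGroup (v.adicCompletion ℚ)) • Q i - Q i) ∧ scalarH1 κ.kerSubgroup (Cofree ρ ↥(padicCoeffField (Set.range ι))) ϖ y = 0} → ∃ (Sg : AddSubgroup (subgroupH1 κ.kerSubgroup (Cofree ρ ↥(padicCoeffField (Set.range ι))))), (↑Sg : Set (subgroupH1 κ.kerSubgroup (Cofree ρ ↥(padicCoeffField (Set.range ι))))) ⊆ {y : subgroupH1 κ.kerSubgroup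 (Cofree ρ ↥(padicCoeffField (Set.range ι))) | y ∈ unramifiedOutside κ.kerSubgroup (Cofree ρ ↥(padicCoeffField (Set.range ι))) 2 ↑S₀ ∧ (∀ w σ, conjH1 κ.kerSubgroup (Cofree ρ ↥(padicCoeffField (Set.range ι))) σ y ∈ infKer κ.kerSubgroup (Cofree ρ ↥(padicCoeffField (Set.range ι))) w) ∧ (∀ v hv σ, ∃ (φ : _) (Q : Fin n → localPoints W (v.adicCompletion ℚ)) (k : ℕ), oneCocycleClass (discreteTopRep ↥κ.kerSubgroup (Cofree ρ ↥(padicCoeffField (Set.range ι)))) φ = conjH1 κ.kerSubgroup (Cofree ρ ↥(padicCoeffField (Set.range ι))) σ y ∧ (∀ i, (2 ^ k) • Q i ∈ ⨆ m : ℕ, signedLocalPoints κ (v.adicCompletion ℚ) W 1 m) ∧ ∀ τ i, pointsMapOfEmb W (closureEmb (K := ℚ) (v.adicCompletion ℚ)) (((Θ v hv (φ.1 (resGalSubgroupOfEmb κ.kerSubgroup (closureEmb (K := ℚ) (v.adicCompletion ℚ)) τ))) i : ↥(W.geomPrimaryTorsion 2)) : W.geomPoints) = (τ : absoluteGaloisGroup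 (v.adicCompletion ℚ)) • Q i - Q i)} ∧ (∀ (r : ↥(padicCoeffIntegers (Set.range ι))) (c : subgroupH1 κ.kerSubgroup (Cofree ρ ↥(padicCoeffField (Set.range ι)))), c ∈ Sg → scalarH1 κ.kerSubgroup (Cofree ρ ↥(padicCoeffField (Set.range ι))) r c ∈ Sg) ∧ ∃ (X : Type) (_ : AddCommGroup X) (_ : Module (IwasawaAlgebraO (Set.range ι)) X) (_ : Module ↥(padicCoeffIntegers (Set.range ι)) X) (_ : IsScalarTower ↥(padicCoeffIntegers (Set.range ι)) (IwasawaAlgebraO (Set.range ι)) X) (_ : Module.Finite (IwasawaAlgebraO (Set.range ι)) X) (_ : Module.Finite ↥(padicCoeffIntegers (Set.range ι)) X) (toDual : X →+ (↥Sg →+ AddCircle (1 : ℚ))), Function.Bijective toDual ∧ (∀ (a : ↥(padicCoeffIntegers (Set.range ι))) (x : X) (s : ↥Sg) (hs : scalarH1 κ.kerSubgroup (Cofree ρ ↥(padicCoeffField (Set.range ι))) a (s : subgroupH1 κ.kerSubgroup (Cofree ρ ↥(padicCoeffField (Set.range ι)))) ∈ Sg), toDual ((PowerSeries.C a : IwasawaAlgebraO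 (Set.range ι)) • x) s = toDual x ⟨scalarH1 κ.kerSubgroup (Cofree ρ ↥(padicCoeffField (Set.range ι))) a (s : subgroupH1 κ.kerSubgroup (Cofree ρ ↥(padicCoeffField (Set.range ι)))), hs⟩) ∧ Module.IsTorsion (IwasawaAlgebraO (Set.range ι)) X ∧
      ∃ (H1Z Xp X0 L : Type) (_ : AddCommGroup H1Z) (_ : Module (IwasawaAlgebraO (Set.range ι)) H1Z) (_ : Module ↥(padicCoeffIntegers (Set.range ι)) H1Z)
        (_ : IsScalarTower ↥(padicCoeffIntegers (Set.range ι)) (IwasawaAlgebraO (Set.range ι)) H1Z) (_ : Module.Finite (IwasawaAlgebraO (Set.range ι)) H1Z)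
        (_ : AddCommGroup Xp) (_ : Module (IwasawaAlgebraO (Set.range ι)) Xp) (_ : Module ↥(padicCoeffIntegers (Set.range ι)) Xp) (_ : IsScalarTower ↥(padicCoeffIntegers (Set.range ι)) (IwasawaAlgebraO (Set.range ι)) Xp)
        (_ : Module.Finite (IwasawaAlgebraO (Set.range ι)) Xp) (_ : AddCommGroup X0) (_ : Module ↥(padicCoeffIntegers (Set.range ι)) X0) (_ : AddCommGroup L) (_ : Module ↥(padicCoeffIntegers (Set.range ι)) L)
        (F : IwasawaAlgebraO (Set.range ι)) (d' : ℕ),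
        F ≠ 0 ∧ (∀ k : ℕ, ‖coeff k (iwasawaOToPowerSeries (Set.range ι) F)‖ ≤ ‖coeff d' (iwasawaOToPowerSeries (Set.range ι) F)‖) ∧
        (∀ k : ℕ, k < d' → ‖coeff k (iwasawaOToPowerSeries (Set.range ι) F)‖ < ‖coeff d' (iwasawaOToPowerSeries (Set.range ι) F)‖) ∧
        d ≤ d' ∧ Module.IsTorsion (IwasawaAlgebraO (Set.range ι)) H1Z ∧ Module.IsTorsion (IwasawaAlgebraO (Set.range ι)) Xp ∧
        (∃ (f₁ : H1Z →ₗ[↥(padicCoeffIntegers (Set.range ι))] ((IwasawaAlgebraO (Set.range ι)) ⧸ Ideal.span {F})) (f₂ : ((IwasawaAlgebraO (Set.range ι)) ⧸ Ideal.span {F}) →ₗ[↥(padicCoeffIntegers (Set.range ι))] Xp)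
          (f₃ : Xp →ₗ[↥(padicCoeffIntegers (Set.range ι))] X0), LinearMap.ker f₂ ≤ LinearMap.range f₁ ∧ LinearMap.range f₂ ≤ LinearMap.ker f₃ ∧ Function.Surjective f₃) ∧
        Module.finrank (FractionRing ↥(padicCoeffIntegers (Set.range ι))) ((FractionRing ↥(padicCoeffIntegers (Set.range ι))) ⊗[↥(padicCoeffIntegers (Set.range ι))] H1Z) ≤ Module.finrank (FractionRing ↥(padicCoeffIntegers (Set.range ι))) ((FractionRing ↥(padicCoeffIntegers (Set.range ι))) ⊗[↥(padicCoeffIntegers (Set.range ι))] X0) ∧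
        (∃ (i₁ : L →ₗ[↥(padicCoeffIntegers (Set.range ι))] X) (π₁ : X →ₗ[↥(padicCoeffIntegers (Set.range ι))] Xp), Function.Injective i₁ ∧ LinearMap.range i₁ ≤ LinearMap.ker π₁ ∧ Function.Surjective π₁ ∧
          ∑ v ∈ S₀, 2 ^ padicValNat 2 ((natGenerator v ^ 2 - 1) / 8) * (if natGenerator v ∣ M then (if ‖embCoeff g ι (natGenerator v) - 1‖ < 1 then 1 else 0) else (if ‖embCoeff g ι (natGenerator v)‖ < 1 then 2 else 0)) ≤ Module.finrank (FractionRing ↥(padicCoeffIntegers (Set.range ι))) ((FractionRing ↥(padicCoeffIntegers (Set.range ι))) ⊗[↥(padicCoeffIntegers (Set.range ι))] L))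

set_option maxHeartbeats 1600000 in
/-- **RSL_g (`stub_cmLambdaLower`'s statement, BY NAME) from the socket bundle.** Infinite branch: `encard = ⊤`
(`natCast_le_encard_of_finite_imp`, honouring Disproof.lean's `natCast_le_encard_of_infinite`); finite branch:
`corank_ge_of_sockets` (§1) ⇒ `d + Σ ≤ rank_𝒪(X/X_tors)` ⇒ `LambdaLowerBoundO.pow_le_encard_of_dualPair_of_subset` ⇒ the count,
and the set identity `{y | unr ∧ arch ∧ Kummer ∧ ϖy = 0} = {y ∈ 𝒮 | ϖy = 0}` exactly as in `cmLambdaLower_of_corank`.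
BSD is not proved; RSL_g (stmt-BirchSwinnertonDyer-22608) and (R≥)ᵖ (stmt-…-26074) remain OPEN — this is glue only.
[cite: Kobayashi2003, Thm. 1.2 / Thm. 7.3] [cite: Kato2004Asterisque, Thm. 12.4, 12.5] [cite: BurungaleTian2026, Thm. 2.6]
[cite: GreenbergVatsal2000, §2] [cite: EmertonPollackWeston2006, Thm. 3.1.1] -/
theorem residualSignedLambdaLowerCMAtTwo_of_corankSockets (hsock : CorankSockets) :
    Summit.BirchSwinnertonDyer.BirchSwinnertonDyer.Theses.ResidualThetaTransportAtTwo.ResidualSignedLambdaLowerCMAtTwo := by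
  intro W _ _ hCM hr0 hss ha2 hΔ M _ g ι Ω hM hnew hcmf ha2g hΩ hcong κ γ hκ hγ hcyc S₀ hS₀ hbad hMS Lp Lm d hpair
    hle hlt n ρ Θ hρ hΘ ϖ hϖ
  refine natCast_le_encard_of_finite_imp fun hfin ↦ ?_
  obtain ⟨Sg, hSg𝒮, hscal, X, iX, iΛ, i𝒪, iT, iF, iF𝒪, toDual, hbij, hC, hXtors, H1Z, Xp, X0, L, _, _, _, _, _, _, _, _, _,
      _, _, _, _, _, F, d', hF, hFle, hFlt, hd, hH, hXp, ⟨f₁, f₂, f₃, hf₁₂, hf₂₃, hf₃⟩, hflank,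
      ⟨i₁, π₁, hi₁, hiπ, hπ₁, hSig⟩⟩ :=
    hsock W hCM hr0 hss ha2 hΔ M g ι Ω hM hnew hcmf ha2g hΩ hcong κ γ hκ hγ hcyc S₀ hS₀ hbad hMS Lp Lm d hpair
      hle hlt n ρ Θ hρ hΘ ϖ hϖ hfin
  haveI : FiniteDimensional ℚ (ModularForms.coeffField g) :=
    ModularForms.IsNewform0.finiteDimensional_coeffField_holds hnew
  haveI : FiniteDimensional ℚ_[2] ↥(padicCoeffField (Set.range ι)) :=
    GreenbergSelmer.finiteDimensional_padicCoeffField ι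
  have hrank := corank_ge_of_sockets (Set.range ι) (FractionRing ↥(padicCoeffIntegers (Set.range ι))) F d' hF hFle hFlt hd
    hH hXp f₁ f₂ f₃ hf₁₂ hf₂₃ hf₃ hflank hXtors i₁ π₁ hi₁ hiπ hπ₁ hSig
  have key := LambdaLowerBoundO.pow_le_encard_of_dualPair_of_subset (Set.range ι) κ ρ Sg (fun r _ hc ↦ hscal r _ hc) _
    hSg𝒮 X toDual hbij (fun a x s ↦ hC a x s (hscal a _ s.2)) ϖ hϖ _ hrank
  refine le_of_le_of_eq key (congrArg Set.encard (Set.ext fun y ↦ ?_))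
  constructor
  · rintro ⟨⟨h1, h2, h3⟩, h4⟩
    exact ⟨h1, h2, h3, h4⟩
  · rintro ⟨h1, h2, h3, h4⟩
    exact ⟨⟨h1, h2, h3⟩, h4⟩

end ByName

end Summit.BirchSwinnertonDyer.BirchSwinnertonDyer.Cruxes.ResidualThetaCountLowerPureAtTwo.StubIdeasK3G4

end
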